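import Mathlib
import HarnessLib
import Summits.KontsevichZagierPeriods.KontsevichZagierPeriods.Theorems.LinRedNormalFormResidualBeyondGenusZeroLadder

/-!
# Route LinRedNormalForm, item `ResidualBeyondGenusZero` (stmt-KontsevichZagierPeriods-3917): the bottom rung of the dimension ladder in transfer form

Companion of `Theorems/LinRedNormalFormResidualBeyondGenusZeroLadder.lean` (the dimension ladder:
`ResidualBeyondGenusZero ↔ Bottom ∧ ∀ d ≥ 1, RelKer d`). Here the BOTTOM RUNG

  `Bottom :≡ ∀ m ∈ closure (gzSet ∪ D₁), eval m = 0 → ∃ g ∈ closure gzSet, m - g ∈ relations`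

(a vanishing `ℤ`-combination of genus-zero and one-dimensional representations is congruent modulo
`KZ.relations` to a genus-zero combination) is put in TRANSFER form, unconditionally
(`bottom_iff_dimOneToGenusZero`):

  `Bottom ↔ ∀ h ∈ closure D₁, (∃ g ∈ closure gzSet, eval g = eval h) → ∃ g' ∈ closure gzSet, h - g' ∈ relations`

— "every one-dimensional combination whose value is a genus-zero value is genus zero modulo moves".
Unlike the separation piece of the dimension-one split (whose transfer form `mix_iff_transfer`,
Theorems/…DimOneTransfer.lean, asks for SOME pair of representatives to be congruent), this transfer is
about EVERY one-dimensional representative, and needs no kernel statement on the one-dimensional sector in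
either direction. Consequences: `residualBeyondGenusZero_iff_dimOneToGenusZero_and_ladder` (the crux,
losslessly, as this transfer plus the rungs) and `dimOneToGenusZero_of_kernel_of_shared` (the transfer at
a value shared with an element of BOTH closures — e.g. a rational constant `[Δ₁, q]` — is one application of
`DimOneKernelInKZ`).

References: M. Kontsevich, D. Zagier, *Periods* (2001), §1.2 (Conjecture 1); A. Huber, S. Müller-Stach,
*Periods and Nori Motives* (2017), Conj. 13.2.1.
-/

noncomputable section

namespace Summit.KontsevichZagierPeriods.ResidualBeyondGenusZero

open Literature.NumberTheory.Transcendental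
open Summit.KontsevichZagierPeriods.KontsevichZagierPeriods.Theses.LinRedNormalForm (ResidualBeyondGenusZero)
open Summit.KontsevichZagierPeriods.ResidualBeyondGenusZero.Negative (gzSet)

/-! ## The bottom rung in transfer form -/

/-- **The bottom rung, transfer form.** `Bottom` (a vanishing element of `closure (gzSet ∪ D₁)` is
congruent modulo relations to a genus-zero combination) is EQUIVALENT, unconditionally, to:
every `ℤ`-combination of one-dimensional representations whose value is the value of SOME
genus-zero combination is itself congruent modulo `KZ.relations` to a genus-zero combination —
"one-dimensional combinations with genus-zero values are genus zero modulo moves". (`⇒`: apply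
`Bottom` to `h - g`; `⇐`: split `m = g + h` along `closure (s ∪ t) = closure s ⊔ closure t`, the
value of `h` being that of `-g`.) No kernel statement on the one-dimensional sector is needed for
either direction. [folklore] -/
theorem bottom_iff_dimOneToGenusZero :
    (∀ m ∈ AddSubgroup.closure (gzSet ∪ (Set.range fun r : KZ.IntegralRep 1 => KZ.of r)), KZ.eval m = 0 →
      ∃ g ∈ AddSubgroup.closure gzSet, m - g ∈ KZ.relations) ↔
    ∀ h ∈ AddSubgroup.closure (Set.range fun r : KZ.IntegralRep 1 => KZ.of r),
      (∃ g ∈ AddSubgroup.closure gzSet, KZ.eval g = KZ.eval h) →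
      ∃ g' ∈ AddSubgroup.closure gzSet, h - g' ∈ KZ.relations := by
  constructor
  · rintro hB h hh ⟨g, hg, hgh⟩
    have hm : h - g ∈ AddSubgroup.closure (gzSet ∪ (Set.range fun r : KZ.IntegralRep 1 => KZ.of r)) :=
      sub_mem (AddSubgroup.closure_mono Set.subset_union_right hh)
        (AddSubgroup.closure_mono Set.subset_union_left hg)
    have hm0 : KZ.eval (h - g) = 0 := by rw [map_sub, hgh, sub_self]
    obtain ⟨g'', hg'', hrel⟩ := hB (h - g) hm hm0
    refine ⟨g + g'', add_mem hg hg'', ?_⟩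
    have e : h - (g + g'') = h - g - g'' := by abel
    rw [e]
    exact hrel
  · intro hT m hm hm0
    rw [AddSubgroup.closure_union] at hm
    obtain ⟨g, hg, h, hh, rfl⟩ := AddSubgroup.mem_sup.1 hm
    have hval : KZ.eval (-g) = KZ.eval h := by
      rw [map_neg]
      rw [map_add] at hm0
      linarith
    obtain ⟨g', hg', hrel⟩ := hT h hh ⟨-g, neg_mem hg, hval⟩
    refine ⟨g + g', add_mem hg hg', ?_⟩
    have e : g + h - (g + g') = h - g' := by abel
    rw [e]
    exact hrel

/-- **Hence the crux in transfer form along dimension one** (lossless): `ResidualBeyondGenusZero`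
holds iff (i) every one-dimensional combination with a genus-zero value is genus zero modulo moves
and (ii) every rung `RelKer d`, `d ≥ 1`, of the dimension ladder holds. [folklore] -/
theorem residualBeyondGenusZero_iff_dimOneToGenusZero_and_ladder :
    ResidualBeyondGenusZero ↔
      (∀ h ∈ AddSubgroup.closure (Set.range fun r : KZ.IntegralRep 1 => KZ.of r),
        (∃ g ∈ AddSubgroup.closure gzSet, KZ.eval g = KZ.eval h) →
        ∃ g' ∈ AddSubgroup.closure gzSet, h - g' ∈ KZ.relations) ∧
      (∀ d, 1 ≤ d → ∀ m ∈ AddSubgroup.closure (gzSet ∪ (Set.range fun r : KZ.IntegralRep (d + 1) => KZ.of r)), KZ.eval m = 0 →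
        ∃ m' ∈ AddSubgroup.closure (gzSet ∪ (Set.range fun r : KZ.IntegralRep d => KZ.of r)), m - m' ∈ KZ.relations) := by
  rw [residualBeyondGenusZero_iff_bottom_and_ladder, bottom_iff_dimOneToGenusZero]

/-- **The transfer form at genus-zero VALUES which are rational is free**: a one-dimensional
combination `h` with a RATIONAL value `q` is congruent to a genus-zero combination as soon as the
vanishing one-dimensional combination `h - [Δ₁, q]`-type difference is a relation — recorded here
abstractly: if every vanishing element of `closure D₁` is a relation (`DimOneKernelInKZ`) and `h`
shares its value with an element `z` lying in BOTH closures, then `h ≡ z`. [folklore] -/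
theorem dimOneToGenusZero_of_kernel_of_shared
    (hK : ∀ h ∈ AddSubgroup.closure (Set.range fun r : KZ.IntegralRep 1 => KZ.of r), KZ.eval h = 0 → h ∈ KZ.relations)
    {h : KZ.FormalRep} (hh : h ∈ AddSubgroup.closure (Set.range fun r : KZ.IntegralRep 1 => KZ.of r))
    {z : KZ.FormalRep} (hz₁ : z ∈ AddSubgroup.closure (Set.range fun r : KZ.IntegralRep 1 => KZ.of r))
    (hz₀ : z ∈ AddSubgroup.closure gzSet) (hval : KZ.eval z = KZ.eval h) :
    ∃ g' ∈ AddSubgroup.closure gzSet, h - g' ∈ KZ.relations :=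
  ⟨z, hz₀, hK (h - z) (sub_mem hh hz₁) (by rw [map_sub, hval, sub_self])⟩

end Summit.KontsevichZagierPeriods.ResidualBeyondGenusZero

end
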